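import Literature.MathematicalPhysics.QuantumFieldTheory.BalabanImbrieJaffe1984to88.BIJ88WalkKernelDecay307

/-!
# `BalabanImbrieJaffe1984to88.BIJ88WalkKernelSourceDecay307` — T. Bałaban, J. Imbrie, A. Jaffe, *Effective action and cluster properties of
the abelian Higgs model*, Commun. Math. Phys. **114** (1988) 257–315 [BalabanImbrieJaffe1988]: pp. 306–307 [PDF 50–51] (Sect. 5.13) — **THE
WALK KERNEL AGAINST THE SOURCE: `Σ_q |(C𝔫(c))(x′,q)|·|ℱ_q|`**.  Print, p. 306: the trains *"ending in either δ/δΦ or ℱ"*; p. 307: *"Functional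
derivatives hitting χ′-factors within ½r(e_k) of Λ₁₀^{(k)c} are connected through C_ω(α) to Λ₁₁^{(k)}, so we get small factors e^{−cr(e_k)} from the
exponential decay of the operators C_s and Δ in C_ω(α). Altogether we have small factors at each end of C_ω(α)"*.

A train that ends in the source contributes the coefficient `(C𝔫(c)ℱ)(p) = Σ_q (C𝔫(c))(p,q)ℱ_q` (`BIJ88TrainsDsetExpansion306.trainCoef`, the
`inl` ends; `BIJ88TrainTermBound307.abs_trainCoef_le`).  `BIJ88WalkKernelDecay307` bounds the kernel entry by entry (fixed endpoint `q`); THIS FILE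
is its SOURCE-INTEGRATED twin: the same certificate calculus for `Σ_q |(C𝔫(c))(x′,q)|·g(q)` with a weight `g ≥ 0` (`g = |ℱ|`), the last stretch
now gauged by the decay-weighted source mass `Σ_q e^{−(δ/2)ρ(x′,q)} g(q) ≤ Eout b` seen from the exit set of the last boundary (small when `ℱ`
lives far from it — p. 307's *"small factors e^{−cr(e_k)}"* at the `ℱ` end):
* §1 `sum_abs_mul_mul_apply_mul_le` — one stretch and one boundary, integrated against `g`;
* §2 `sum_abs_C_mul_wker_apply_mul_le_of_forall_erase`, **`sum_abs_C_mul_wker_apply_mul_le`** (supersolution form on exit sets),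
  **`sum_abs_C_mul_wker_apply_mul_le_entry`** (from any site), `abs_C_mul_wker_mulVec_le_entry` (`|(C𝔫(c)ℱ)(p)| ≤ …` with `g = |ℱ|`).

statement-level skeleton of published theorems with citation tags; proofs where landed; nothing here is a claim about the Yang–Mills mass gap

PDF held: `paper:balaban1988-cmp114-bij-abelian-higgs-effective-action` (journal page = PDF page + 256); pages re-read this session as text:
PDF 50 (p. 306), PDF 51 (p. 307) L10–14.

CITATION HEADER (lean-in-tree rule).  Part of the lit-balaban TYPED SKELETON (HOME `run/shared/lean/pub/lit-balaban/`), Phase 2, seat p36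
(gen 21, unit `lit-balaban-p36`); rows **C2.Eq5.14.3-5.14.4** (member: §f estimate E2/E4d — the source end of the trains) and C2.Eq5.13.3-5.13.4
(member) of `HOME/lit-balaban-r16/ROWS-C2-part2.md` (owner r16, referee ref-5).  Theorem-only; no definitions, no `Prop` facts; axioms standard.

REVISION (doc-only, referee/owner items N-ref1-g107-2 / N-ref1-g115-1 / D-owner-v2.389): the p. 307 L5–13 quotation above now carries print's region symbols
`Λ₁₀^{(k)c}` / `Λ₁₁^{(k)}` and *"χ′-factors"* where applicable; no declaration changed.
-/

namespace Literature.MathematicalPhysics.QuantumFieldTheory.BalabanImbrieJaffe1984to88.BIJ88WalkKernelSourceDecay307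

open Finset Matrix
open scoped BigOperators
open BIJ88TrainPieces306 (wker wker_empty wker_eq)

variable {α : Type} [Fintype α]

/-! ## §1  One stretch and one boundary, integrated against the source weight -/

/-- **ONE STRETCH AND ONE BOUNDARY AGAINST A WEIGHT `g ≥ 0`**: with the letters of `BIJ88WalkKernelDecay307.abs_mul_mul_apply_le` and the
continuation bounded in the integrated form `Σ_q |M(x′,q)| g(q) ≤ B` on `U′`: `Σ_q |(X N M)(y,q)| g(q) ≤ a·Z·m·e·B`.
[cite: BalabanImbrieJaffe1988, §5.13 p.306–307] -/
theorem sum_abs_mul_mul_apply_mul_le {X N M : Matrix α α ℝ} {ρ : α → α → ℝ} {a δ Z m e B : ℝ} {U U' : Set α} {g : α → ℝ}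
    (hg : ∀ q, 0 ≤ g q) (hX : ∀ y x, |X y x| ≤ a * Real.exp (-(δ * ρ y x))) (hZ : ∀ y, ∑ x, Real.exp (-(δ / 2 * ρ y x)) ≤ Z)
    (hsupp : ∀ x x', N x x' ≠ 0 → x ∈ U ∧ x' ∈ U') (hrow : ∀ x, ∑ x', |N x x'| ≤ m) (he : 0 ≤ e) (hB : 0 ≤ B) (y : α)
    (heU : ∀ x ∈ U, Real.exp (-(δ / 2 * ρ y x)) ≤ e) (hM : ∀ x' ∈ U', ∑ q, |M x' q| * g q ≤ B) :
    ∑ q, |(X * N * M) y q| * g q ≤ a * Z * m * e * B := by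
  have hm : 0 ≤ m := (sum_nonneg fun _ _ => abs_nonneg _).trans (hrow y)
  have ha : 0 ≤ a := by
    by_contra h
    have h' : a * Real.exp (-(δ * ρ y y)) < 0 := mul_neg_of_neg_of_pos (lt_of_not_ge h) (Real.exp_pos _)
    linarith [abs_nonneg (X y y), hX y y]
  -- the continuation through the boundary term, integrated: `Σ_q |(NM)(x,q)| g q ≤ m B`, and `= 0` off `U`
  have hT : ∀ x, ∑ q, |(N * M) x q| * g q ≤ m * B := fun x => by
    calc ∑ q, |(N * M) x q| * g q ≤ ∑ q, (∑ x', |N x x'| * |M x' q|) * g q := sum_le_sum fun q _ => by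
            refine mul_le_mul_of_nonneg_right ?_ (hg q)
            rw [Matrix.mul_apply]
            exact (abs_sum_le_sum_abs _ _).trans (le_of_eq (sum_congr rfl fun x' _ => abs_mul _ _))
      _ = ∑ x', |N x x'| * ∑ q, |M x' q| * g q := by
            simp only [sum_mul, mul_sum, mul_assoc]
            exact sum_comm
      _ ≤ ∑ x', |N x x'| * B := sum_le_sum fun x' _ => by
            by_cases h : N x x' = 0
            · rw [h, abs_zero, zero_mul, zero_mul]
            · exact mul_le_mul_of_nonneg_left (hM x' (hsupp x x' h).2) (abs_nonneg _)
      _ ≤ m * B := by rw [← sum_mul]; exact mul_le_mul_of_nonneg_right (hrow x) hB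
  have hT0 : ∀ x, x ∉ U → ∑ q, |(N * M) x q| * g q = 0 := fun x hx => by
    refine sum_eq_zero fun q _ => ?_
    rw [Matrix.mul_apply, sum_eq_zero fun x' _ => ?_, abs_zero, zero_mul]
    have h0 : N x x' = 0 := by
      by_contra h
      exact hx (hsupp x x' h).1
    rw [h0, zero_mul]
  have key : ∀ x, |X y x| * ∑ q, |(N * M) x q| * g q ≤ a * Real.exp (-(δ / 2 * ρ y x)) * (m * e * B) := fun x => by
    by_cases hx : x ∈ U
    · have h1 : |X y x| ≤ a * Real.exp (-(δ / 2 * ρ y x)) * e := by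
        refine (hX y x).trans ?_
        have h2 : Real.exp (-(δ * ρ y x)) = Real.exp (-(δ / 2 * ρ y x)) * Real.exp (-(δ / 2 * ρ y x)) := by
          rw [← Real.exp_add]; congr 1; ring
        rw [h2, ← mul_assoc]
        exact mul_le_mul_of_nonneg_left (heU x hx) (by positivity)
      calc |X y x| * ∑ q, |(N * M) x q| * g q ≤ (a * Real.exp (-(δ / 2 * ρ y x)) * e) * (m * B) :=
            mul_le_mul h1 (hT x) (sum_nonneg fun q _ => mul_nonneg (abs_nonneg _) (hg q)) (by positivity)
        _ = _ := by ring
    · rw [hT0 x hx, mul_zero]; positivity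
  calc ∑ q, |(X * N * M) y q| * g q ≤ ∑ q, (∑ x, |X y x| * |(N * M) x q|) * g q := sum_le_sum fun q _ => by
          refine mul_le_mul_of_nonneg_right ?_ (hg q)
          rw [Matrix.mul_assoc, Matrix.mul_apply]
          exact (abs_sum_le_sum_abs _ _).trans (le_of_eq (sum_congr rfl fun x _ => abs_mul _ _))
    _ = ∑ x, |X y x| * ∑ q, |(N * M) x q| * g q := by
          simp only [sum_mul, mul_sum, mul_assoc]
          exact sum_comm
    _ ≤ ∑ x, a * Real.exp (-(δ / 2 * ρ y x)) * (m * e * B) := sum_le_sum fun x _ => key x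
    _ = a * (∑ x, Real.exp (-(δ / 2 * ρ y x))) * (m * e * B) := by rw [mul_sum, sum_mul]
    _ ≤ a * Z * (m * e * B) := by gcongr; exact hZ y
    _ = a * Z * m * e * B := by ring

/-! ## §2  The walk kernel against the source weight: supersolutions bound it -/

variable [DecidableEq α] {I : Type} [DecidableEq I]

/-- entering `𝔫(c)` (`c ≠ ∅`) from a site `y`, integrated against `g`: the recursion `𝔫(c) = Σ_{b′∈c} N_{b′} C 𝔫(c∖b′)` estimated term by term
with §1. [cite: BalabanImbrieJaffe1988, §5.13 p.306–307] -/
theorem sum_abs_C_mul_wker_apply_mul_le_of_forall_erase {C : Matrix α α ℝ} {N : Finset I → Matrix α α ℝ} {ρ : α → α → ℝ}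
    {a δ Z m : ℝ} {U U' : Finset I → Set α} {g : α → ℝ} (hg : ∀ q, 0 ≤ g q) (hC : ∀ y x, |C y x| ≤ a * Real.exp (-(δ * ρ y x)))
    (hZ : ∀ y, ∑ x, Real.exp (-(δ / 2 * ρ y x)) ≤ Z) (hsupp : ∀ b x x', N b x x' ≠ 0 → x ∈ U b ∧ x' ∈ U' b)
    (hrow : ∀ b x, ∑ x', |N b x x'| ≤ m) (y : α) {c : Finset (Finset I)} (hc : c.Nonempty) {e B : Finset I → ℝ}
    (he0 : ∀ b' ∈ c, 0 ≤ e b') (he : ∀ b' ∈ c, ∀ x ∈ U b', Real.exp (-(δ / 2 * ρ y x)) ≤ e b') (hB0 : ∀ b' ∈ c, 0 ≤ B b')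
    (hB : ∀ b' ∈ c, ∀ x' ∈ U' b', ∑ q, |(C * wker C N (c.erase b')) x' q| * g q ≤ B b') :
    ∑ q, |(C * wker C N c) y q| * g q ≤ a * Z * m * ∑ b' ∈ c, e b' * B b' := by
  have hL : ∀ q, (C * wker C N c) y q = ∑ b' ∈ c, (C * N b' * (C * wker C N (c.erase b'))) y q := fun q => by
    rw [wker_eq C N hc, Finset.mul_sum, Matrix.sum_apply]
    exact sum_congr rfl fun b' _ => by simp only [Matrix.mul_assoc]
  calc ∑ q, |(C * wker C N c) y q| * g q ≤ ∑ q, (∑ b' ∈ c, |(C * N b' * (C * wker C N (c.erase b'))) y q|) * g q :=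
        sum_le_sum fun q _ => by rw [hL q]; exact mul_le_mul_of_nonneg_right (abs_sum_le_sum_abs _ _) (hg q)
    _ = ∑ b' ∈ c, ∑ q, |(C * N b' * (C * wker C N (c.erase b'))) y q| * g q := by simp only [sum_mul]; exact sum_comm
    _ ≤ ∑ b' ∈ c, a * Z * m * e b' * B b' := sum_le_sum fun b' hb' =>
        sum_abs_mul_mul_apply_mul_le hg hC hZ (hsupp b') (hrow b') (he0 b' hb') (hB0 b' hb') y (he b' hb') (hB b' hb')
    _ = a * Z * m * ∑ b' ∈ c, e b' * B b' := by rw [mul_sum]; exact sum_congr rfl fun b' _ => by ring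

/-- **THE WALK KERNEL AGAINST THE SOURCE WEIGHT (supersolution form).**  Letters as in `BIJ88WalkKernelDecay307.abs_C_mul_wker_apply_le`, except
that the last stretch is gauged in the integrated form `Σ_q e^{−(δ/2)ρ(x′,q)} g(q) ≤ Eout b` for `x′ ∈ U′_b` (the decay-weighted source mass seen
from the exit set of `b`); `W ≥ 0` a supersolution (`Eout b ≤ W b ∅`, `Σ_{b′∈c} E b b′ · W b′ (c∖b′) ≤ W b c`).  Then on every exit set
`Σ_q |(C𝔫(c))(x′,q)| g(q) ≤ a · (aZm)^{|c|} · W b c`. [cite: BalabanImbrieJaffe1988, §5.13 p.306–307] -/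
theorem sum_abs_C_mul_wker_apply_mul_le {C : Matrix α α ℝ} {N : Finset I → Matrix α α ℝ} {ρ : α → α → ℝ} {a δ Z m : ℝ}
    {U U' : Finset I → Set α} {g : α → ℝ} (hg : ∀ q, 0 ≤ g q) (hρ : ∀ y x, 0 ≤ ρ y x) (hδ : 0 ≤ δ)
    (hC : ∀ y x, |C y x| ≤ a * Real.exp (-(δ * ρ y x))) (hZ : ∀ y, ∑ x, Real.exp (-(δ / 2 * ρ y x)) ≤ Z)
    (hsupp : ∀ b x x', N b x x' ≠ 0 → x ∈ U b ∧ x' ∈ U' b) (hrow : ∀ b x, ∑ x', |N b x x'| ≤ m)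
    {E : Finset I → Finset I → ℝ} {Eout : Finset I → ℝ} (hE0 : ∀ b b', 0 ≤ E b b')
    (hE : ∀ b b', ∀ x' ∈ U' b, ∀ x ∈ U b', Real.exp (-(δ / 2 * ρ x' x)) ≤ E b b')
    (hEout : ∀ b, ∀ x' ∈ U' b, ∑ q, Real.exp (-(δ / 2 * ρ x' q)) * g q ≤ Eout b) {W : Finset I → Finset (Finset I) → ℝ}
    (hW0 : ∀ b c, 0 ≤ W b c) (hWe : ∀ b, Eout b ≤ W b ∅) (hWs : ∀ b c, c.Nonempty → ∑ b' ∈ c, E b b' * W b' (c.erase b') ≤ W b c)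
    (c : Finset (Finset I)) :
    ∀ (b : Finset I), ∀ x' ∈ U' b, ∑ q, |(C * wker C N c) x' q| * g q ≤ a * (a * Z * m) ^ c.card * W b c := by
  induction c using Finset.strongInduction with
  | H c ih =>
    intro b x' hx'
    have ha : 0 ≤ a := by
      by_contra h
      have h' : a * Real.exp (-(δ * ρ x' x')) < 0 := mul_neg_of_neg_of_pos (lt_of_not_ge h) (Real.exp_pos _)
      linarith [abs_nonneg (C x' x'), hC x' x']
    have hZ0 : 0 ≤ Z := (sum_nonneg fun _ _ => (Real.exp_pos _).le).trans (hZ x')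
    have hm : 0 ≤ m := (sum_nonneg fun _ _ => abs_nonneg _).trans (hrow b x')
    rcases c.eq_empty_or_nonempty with rfl | hc
    · rw [wker_empty, Matrix.mul_one, card_empty, pow_zero, mul_one]
      have h1 : ∀ q, |C x' q| * g q ≤ a * (Real.exp (-(δ / 2 * ρ x' q)) * g q) := fun q => by
        rw [← mul_assoc]
        refine mul_le_mul_of_nonneg_right ((hC x' q).trans (mul_le_mul_of_nonneg_left
          (Real.exp_le_exp.2 (by linarith [mul_nonneg hδ (hρ x' q)])) ha)) (hg q)
      calc ∑ q, |C x' q| * g q ≤ ∑ q, a * (Real.exp (-(δ / 2 * ρ x' q)) * g q) := sum_le_sum fun q _ => h1 q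
        _ = a * ∑ q, Real.exp (-(δ / 2 * ρ x' q)) * g q := by rw [mul_sum]
        _ ≤ a * W b ∅ := mul_le_mul_of_nonneg_left ((hEout b x' hx').trans (hWe b)) ha
    · obtain ⟨k, hk⟩ := Nat.exists_eq_add_one_of_ne_zero (card_ne_zero.2 hc)
      have hB : ∀ b' ∈ c, ∀ x'' ∈ U' b',
          ∑ q, |(C * wker C N (c.erase b')) x'' q| * g q ≤ a * (a * Z * m) ^ k * W b' (c.erase b') := by
        intro b' hb' x'' hx''
        have h := ih (c.erase b') (erase_ssubset hb') b' x'' hx''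
        rwa [card_erase_of_mem hb', hk, Nat.add_sub_cancel] at h
      refine (sum_abs_C_mul_wker_apply_mul_le_of_forall_erase hg hC hZ hsupp hrow x' hc (fun b' _ => hE0 b b')
        (fun b' _ x hx => hE b b' x' hx' x hx) (fun b' _ => mul_nonneg (mul_nonneg ha (pow_nonneg (by positivity) k)) (hW0 _ _))
        hB).trans ?_
      calc a * Z * m * ∑ b' ∈ c, E b b' * (a * (a * Z * m) ^ k * W b' (c.erase b'))
          = a * (a * Z * m) ^ c.card * ∑ b' ∈ c, E b b' * W b' (c.erase b') := by
            rw [hk, pow_succ, Finset.mul_sum, Finset.mul_sum]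
            exact sum_congr rfl fun b' _ => by ring
        _ ≤ a * (a * Z * m) ^ c.card * W b c := mul_le_mul_of_nonneg_left (hWs b c hc) (by positivity)

/-- **… FROM ANY SITE `p`** (`c ≠ ∅`), entrance gauges `Ein b′ ≥ e^{−(δ/2)ρ(p,x)}` on `U_{b′}`:
`Σ_q |(C𝔫(c))(p,q)| g(q) ≤ a · (aZm)^{|c|} · Σ_{b′∈c} Ein b′ · W b′ (c∖b′)`. [cite: BalabanImbrieJaffe1988, §5.13 p.306–307] -/
theorem sum_abs_C_mul_wker_apply_mul_le_entry {C : Matrix α α ℝ} {N : Finset I → Matrix α α ℝ} {ρ : α → α → ℝ} {a δ Z m : ℝ}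
    {U U' : Finset I → Set α} {g : α → ℝ} (hg : ∀ q, 0 ≤ g q) (hρ : ∀ y x, 0 ≤ ρ y x) (hδ : 0 ≤ δ)
    (hC : ∀ y x, |C y x| ≤ a * Real.exp (-(δ * ρ y x))) (hZ : ∀ y, ∑ x, Real.exp (-(δ / 2 * ρ y x)) ≤ Z)
    (hsupp : ∀ b x x', N b x x' ≠ 0 → x ∈ U b ∧ x' ∈ U' b) (hrow : ∀ b x, ∑ x', |N b x x'| ≤ m)
    {E : Finset I → Finset I → ℝ} {Eout : Finset I → ℝ} (hE0 : ∀ b b', 0 ≤ E b b')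
    (hE : ∀ b b', ∀ x' ∈ U' b, ∀ x ∈ U b', Real.exp (-(δ / 2 * ρ x' x)) ≤ E b b')
    (hEout : ∀ b, ∀ x' ∈ U' b, ∑ q, Real.exp (-(δ / 2 * ρ x' q)) * g q ≤ Eout b) {W : Finset I → Finset (Finset I) → ℝ}
    (hW0 : ∀ b c, 0 ≤ W b c) (hWe : ∀ b, Eout b ≤ W b ∅) (hWs : ∀ b c, c.Nonempty → ∑ b' ∈ c, E b b' * W b' (c.erase b') ≤ W b c)
    (p : α) {Ein : Finset I → ℝ} (hEin0 : ∀ b', 0 ≤ Ein b') (hEin : ∀ b', ∀ x ∈ U b', Real.exp (-(δ / 2 * ρ p x)) ≤ Ein b')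
    {c : Finset (Finset I)} (hc : c.Nonempty) :
    ∑ q, |(C * wker C N c) p q| * g q ≤ a * (a * Z * m) ^ c.card * ∑ b' ∈ c, Ein b' * W b' (c.erase b') := by
  obtain ⟨b₀, hb₀⟩ := id hc
  have ha : 0 ≤ a := by
    by_contra h
    have h' : a * Real.exp (-(δ * ρ p p)) < 0 := mul_neg_of_neg_of_pos (lt_of_not_ge h) (Real.exp_pos _)
    linarith [abs_nonneg (C p p), hC p p]
  have hZ0 : 0 ≤ Z := (sum_nonneg fun _ _ => (Real.exp_pos _).le).trans (hZ p)
  have hm : 0 ≤ m := (sum_nonneg fun _ _ => abs_nonneg _).trans (hrow b₀ p)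
  obtain ⟨k, hk⟩ := Nat.exists_eq_add_one_of_ne_zero (card_ne_zero.2 hc)
  have hB : ∀ b' ∈ c, ∀ x'' ∈ U' b',
      ∑ q, |(C * wker C N (c.erase b')) x'' q| * g q ≤ a * (a * Z * m) ^ k * W b' (c.erase b') := by
    intro b' hb' x'' hx''
    have h := sum_abs_C_mul_wker_apply_mul_le hg hρ hδ hC hZ hsupp hrow hE0 hE hEout hW0 hWe hWs (c.erase b') b' x'' hx''
    rwa [card_erase_of_mem hb', hk, Nat.add_sub_cancel] at h
  refine (sum_abs_C_mul_wker_apply_mul_le_of_forall_erase hg hC hZ hsupp hrow p hc (fun b' _ => hEin0 b')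
    (fun b' _ x hx => hEin b' x hx) (fun b' _ => mul_nonneg (mul_nonneg ha (pow_nonneg (by positivity) k)) (hW0 _ _)) hB).trans
    (le_of_eq ?_)
  rw [hk, pow_succ, Finset.mul_sum, Finset.mul_sum]
  exact sum_congr rfl fun b' _ => by ring

/-- **THE SOURCE END OF A TRAIN**: `|(C𝔫(c)ℱ)(p)| ≤ Σ_q |(C𝔫(c))(p,q)|·|ℱ_q| ≤ a · (aZm)^{|c|} · Σ_{b′∈c} Ein b′ · W b′ (c∖b′)` with the letters of
`sum_abs_C_mul_wker_apply_mul_le_entry` for the weight `g = |ℱ|` (p. 307: the `ℱ` end of `C_ω(α)` carries the decay between the source and the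
walk). [cite: BalabanImbrieJaffe1988, §5.13 p.306–307] -/
theorem abs_C_mul_wker_mulVec_le_entry {C : Matrix α α ℝ} {N : Finset I → Matrix α α ℝ} {ρ : α → α → ℝ} {a δ Z m : ℝ}
    {U U' : Finset I → Set α} (f : α → ℝ) (hρ : ∀ y x, 0 ≤ ρ y x) (hδ : 0 ≤ δ)
    (hC : ∀ y x, |C y x| ≤ a * Real.exp (-(δ * ρ y x))) (hZ : ∀ y, ∑ x, Real.exp (-(δ / 2 * ρ y x)) ≤ Z)
    (hsupp : ∀ b x x', N b x x' ≠ 0 → x ∈ U b ∧ x' ∈ U' b) (hrow : ∀ b x, ∑ x', |N b x x'| ≤ m)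
    {E : Finset I → Finset I → ℝ} {Eout : Finset I → ℝ} (hE0 : ∀ b b', 0 ≤ E b b')
    (hE : ∀ b b', ∀ x' ∈ U' b, ∀ x ∈ U b', Real.exp (-(δ / 2 * ρ x' x)) ≤ E b b')
    (hEout : ∀ b, ∀ x' ∈ U' b, ∑ q, Real.exp (-(δ / 2 * ρ x' q)) * |f q| ≤ Eout b) {W : Finset I → Finset (Finset I) → ℝ}
    (hW0 : ∀ b c, 0 ≤ W b c) (hWe : ∀ b, Eout b ≤ W b ∅) (hWs : ∀ b c, c.Nonempty → ∑ b' ∈ c, E b b' * W b' (c.erase b') ≤ W b c)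
    (p : α) {Ein : Finset I → ℝ} (hEin0 : ∀ b', 0 ≤ Ein b') (hEin : ∀ b', ∀ x ∈ U b', Real.exp (-(δ / 2 * ρ p x)) ≤ Ein b')
    {c : Finset (Finset I)} (hc : c.Nonempty) :
    |((C * wker C N c) *ᵥ f) p| ≤ a * (a * Z * m) ^ c.card * ∑ b' ∈ c, Ein b' * W b' (c.erase b') := by
  refine le_trans ?_ (sum_abs_C_mul_wker_apply_mul_le_entry (fun q => abs_nonneg (f q)) hρ hδ hC hZ hsupp hrow hE0 hE hEout hW0 hWe
    hWs p hEin0 hEin hc)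
  rw [Matrix.mulVec, dotProduct]
  exact (abs_sum_le_sum_abs _ _).trans (le_of_eq (sum_congr rfl fun q _ => abs_mul _ _))

end Literature.MathematicalPhysics.QuantumFieldTheory.BalabanImbrieJaffe1984to88.BIJ88WalkKernelSourceDecay307
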